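import Mathlib
import HarnessLib
import Summits.Langlands.Langlands.Theses.ParityBlindBianchi
import Summits.Langlands.Langlands.Theses.RuelleTorsionArtinWeight
import Summits.Langlands.Langlands.Theorems.ParityBlindBianchiArtinWeightRealisationLevelOddBaseChangeSector
import Summits.Langlands.Langlands.Theorems.ParityBlindBianchiArtinWeightRealisationLevelRouteSectorTarget
import Summits.Langlands.Langlands.Theorems.ParityBlindBianchiArtinWeightRealisationLevelStubIsIrreducibleTwistIff
import Summits.Langlands.Langlands.Theorems.ParityBlindBianchiArtinWeightRealisationLevelStubFiniteRangeTwist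
import Summits.Langlands.Langlands.Theorems.ParityBlindBianchiArtinWeightRealisationLevelStubExistsEventuallySatakeFrobCompatibleAtTwist

/-!
# The descent-up-to-twist sector of R′ of EITHER parity, from the route's own target, and the
# non-descending residue — helper file (`--supports stmt-Langlands-15111`), line `Sketch`,
# continuation lead c15

Crux R′ = `ParityBlindBianchi.ArtinWeightRealisationLevel` (and the shared crux R =
`RuelleTorsionArtinWeight.ArtinWeightRealisation`, item stmt-Langlands-11057).  Combining the
parity-free base-change chain and `strongArtin_rat_two_of_target` (`…RouteSectorTarget`: LT + KW +
Booker + the route's TARGET `EvenIcosahedralStrongArtin` ⇒ strong Artin over `ℚ` for every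
irreducible `Γ_ℚ → GL₂(ℂ)`) with the twisting engine
`stub_exists_eventually_satakeFrobCompatibleAt_twist` (class field theory + twisting of cuspidal
Borel–Jacquet data, both PROVED), this file closes the DESCENT-UP-TO-TWIST sector of either parity

  `σ = (ρ|_{Γ_K}) ⊗ ψ`,  `ρ : Γ_ℚ → GL₂(ℚ̄_p)` of finite image (any parity),  `ψ : Γ_K → ℚ̄_pˣ` of
  finite image,

modulo LT, KW, Booker, TARGET, Arthur–Clozel 4.2 (a) (+ JL for every good place), and reduces both
cruxes to their NON-DESCENDING residue:

* `eventually_satakeFrobCompatibleAt_twist_restrictField_of_strongArtin` (a.e.; displayed strong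
  Artin over `ℚ` + `baseChange_cyclic_cuspidal`), `satakeFrobCompatibleAt_twist_restrictField_of_strongArtin`
  (+ Gelbart 4.1 displayed: every unramified place);
* `artinWeightRealisationLevel_descent_sector_of_target` — R′ verbatim on the sector, from
  LT + KW + Booker + TARGET + AC + JL;
* `artinWeightRealisationLevel_of_nondescending_sector` — modulo those six, R′ follows from its
  restriction to the `σ` with insoluble projective image that are NOT `(ρ|_{Γ_K}) ⊗ ψ` for any
  finite-image `ρ`, `ψ` — the "genuinely Bianchi" icosahedral `σ`, a sector the route never consumes
  (`route_instance_mem_descent_sector`, `…RouteSector`);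
* `artinWeightRealisation_descent_sector_of_target`, `artinWeightRealisation_of_nondescending_sector`
  — the same for the shared crux R (a.e.; no Hecke theory).

So, kernel-checked: modulo theorems in print, R′ = (a consequence of the route's target on the
descent sector) + (an open statement about non-descending icosahedral `σ` over `K` that the route
does not use).  All theorems are registered stubs on stmt-Langlands-15111; no definitions, no new
named facts.
-/

noncomputable section

open scoped BigOperators Topology Classical Matrix NumberField MatrixGroups
open Literature.NumberTheory.Automorphic Literature.NumberTheory.GaloisRepresentations
  IsDedekindDomain NumberField Filter

-- `Summit.Langlands.Langlands.…`: summit = sub-problem name (D-0017 nested layout), not a typo.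
set_option linter.dupNamespace false

namespace Summit.Langlands.Langlands.Theorems.ArtinWeightRealisationLevel

/-- **The descent-up-to-twist sector of either parity, almost-everywhere form (displayed
hypotheses; no Hecke theory).**  Strong Artin over `ℚ` for every irreducible two-dimensional
Artin representation (`hSA`) and `baseChange_cyclic_cuspidal` (`hBC`) give, for `K` quadratic,
`ρ : Γ_ℚ → GL₂(ℚ̄_p)` of finite image with `ρ|_{Γ_K}` irreducible and `ψ : Γ_K → ℚ̄_pˣ` of finite
image, a cuspidal `π` of `GL₂(𝔸_K)` compatible with `(ρ|_{Γ_K}) ⊗ ψ` at almost every place: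
`eventually_satakeFrobCompatibleAt_restrictField_of_strongArtin` twisted by
`stub_exists_eventually_satakeFrobCompatibleAt_twist` (class field theory + twisting). [folklore] -/
theorem eventually_satakeFrobCompatibleAt_twist_restrictField_of_strongArtin : (∀ ρ : Literature.NumberTheory.GaloisRepresentations.FramedArtinRep ℚ 2, ρ.toGaloisRep.IsIrreducible → ∃ (hcpt : Literature.NumberTheory.Automorphic.isCompact_glFiniteIntegralLevel 2 ℚ) (π : Literature.NumberTheory.Automorphic.CuspidalAutomorphicRepData 2 ℚ hcpt), Literature.NumberTheory.Automorphic.IsPiOfArtinRep ρ π.1) → Literature.NumberTheory.Automorphic.baseChange_cyclic_cuspidal → ∀ (K : Type) [Field K] [NumberField K], Module.finrank ℚ K = 2 → ∀ (p : ℕ) [Fact p.Prime] (ι : PadicAlgCl p ≃+* ℂ) (ρ : Literature.NumberTheory.GaloisRepresentations.FramedGaloisRep ℚ (PadicAlgCl p) 2), Finite ρ.toMonoidHom.range → (ρ.restrictField K).toGaloisRep.IsIrreducible → ∀ ψ : Field.absoluteGaloisGroup K →ₜ* (PadicAlgCl p)ˣ, Finite ψ.toMonoidHom.range → ∃ (hcpt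 : Literature.NumberTheory.Automorphic.isCompact_glFiniteIntegralLevel 2 K) (π : Literature.NumberTheory.Automorphic.CuspidalAutomorphicRepData 2 K hcpt), ∀ᶠ w : IsDedekindDomain.HeightOneSpectrum (NumberField.RingOfIntegers K) in Filter.cofinite, Summit.Langlands.SatakeFrobCompatibleAt ι π.1 (Literature.NumberTheory.GaloisRepresentations.FramedRep.twist (ρ.restrictField K) ψ) w := by
  intro hSA hBC K _ _ hK p _ ι ρ hfin hirr ψ hψ
  obtain ⟨hcpt, π₀, hae⟩ :=
    eventually_satakeFrobCompatibleAt_restrictField_of_strongArtin hSA hBC K hK p ι ρ hfin hirr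
  obtain ⟨π, hπ⟩ := stub_exists_eventually_satakeFrobCompatibleAt_twist K p ι hcpt π₀
    (ρ.restrictField K) ψ hψ hae
  exact ⟨hcpt, π, hπ⟩

/-- **The descent-up-to-twist sector of either parity at EVERY unramified place (displayed
hypotheses)**, adding the σ-unramified shadow of Gelbart 1997 Prop. 4.1 (`hG`, written out): the
landed rigidity `satakeFrobCompatibleAt_of_eventually_of_isUnramifiedAt hG` (finite image of the
twist: `stub_finite_range_twist`). [folklore] -/
theorem satakeFrobCompatibleAt_twist_restrictField_of_strongArtin : (∀ ρ : Literature.NumberTheory.GaloisRepresentations.FramedArtinRep ℚ 2, ρ.toGaloisRep.IsIrreducible → ∃ (hcpt : Literature.NumberTheory.Automorphic.isCompact_glFiniteIntegralLevel 2 ℚ) (π : Literature.NumberTheory.Automorphic.CuspidalAutomorphicRepData 2 ℚ hcpt), Literature.NumberTheory.Automorphic.IsPiOfArtinRep ρ π.1) → Literature.NumberTheory.Automorphic.baseChange_cyclic_cuspidal → (∀ {F : Type} [Field F] [NumberField F] (hcpt : Literature.NumberTheory.Automorphic.isCompact_glFiniteIntegralLevel 2 F) (σ : Literature.NumberTheory.GaloisRepresentations.FramedArtinRep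 F 2) (π : Literature.NumberTheory.Automorphic.CuspidalAutomorphicRepData 2 F hcpt), Literature.NumberTheory.Automorphic.IsPiOfArtinRep σ π.1 → ∀ v : IsDedekindDomain.HeightOneSpectrum (NumberField.RingOfIntegers F), σ.IsUnramifiedAt v → Literature.NumberTheory.Automorphic.FrobSatakeCompatibleAt σ π.1 v) → ∀ (K : Type) [Field K] [NumberField K], Module.finrank ℚ K = 2 → ∀ (p : ℕ) [Fact p.Prime] (ι : PadicAlgCl p ≃+* ℂ) (ρ : Literature.NumberTheory.GaloisRepresentations.FramedGaloisRep ℚ (PadicAlgCl p) 2), Finite ρ.toMonoidHom.range → (ρ.restrictField K).toGaloisRep.IsIrreducible → ∀ ψ : Field.absoluteGaloisGroup K →ₜ* (PadicAlgCl p)ˣ, Finite ψ.toMonoidHom.range → ∃ (hcpt : Literature.NumberTheory.Automorphic.isCompact_glFiniteIntegralLevel 2 K) (π : Literature.NumberTheory.Automorphic.CuspidalAutomorphicRepData 2 K hcpt), ∀ w : IsDedekindDomain.HeightOneSpectrum (NumberField.RingOfIntegers K), Literature.NumberTheory.GaloisRepresentations.FramedGaloisRep.IsUnramifiedAt w (Literature.NumberTheory.GaloisRepresentations.FramedRep.twist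 (ρ.restrictField K) ψ) → Summit.Langlands.SatakeFrobCompatibleAt ι π.1 (Literature.NumberTheory.GaloisRepresentations.FramedRep.twist (ρ.restrictField K) ψ) w := by
  intro hSA hBC hG K _ _ hK p _ ι ρ hfin hirr ψ hψ
  obtain ⟨hcpt, π, hae⟩ :=
    eventually_satakeFrobCompatibleAt_twist_restrictField_of_strongArtin hSA hBC K hK p ι ρ hfin hirr ψ hψ
  have hfinσ : Finite (FramedRep.twist (ρ.restrictField K) ψ).toMonoidHom.range :=
    stub_finite_range_twist K (PadicAlgCl p) 2 (ρ.restrictField K) ψ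
      (finite_range_restrictField K ρ hfin) hψ
  exact ⟨hcpt, π, fun w hw => satakeFrobCompatibleAt_of_eventually_of_isUnramifiedAt hG K p ι
    (FramedRep.twist (ρ.restrictField K) ψ) hfinσ hcpt π hae w hw⟩

/-- **R′ on the descent-up-to-twist sector of either parity, from the route's own target.**
Modulo Langlands–Tunnell, KW odd Artin, Booker, the TARGET `EvenIcosahedralStrongArtin` of route
`ParityBlindBianchi` (item stmt-Langlands-2903), Arthur–Clozel 4.2 (a) and JL, the crux
`ArtinWeightRealisationLevel` holds for every `σ = (ρ|_{Γ_K}) ⊗ ψ` with `ρ : Γ_ℚ → GL₂(ℚ̄_p)` of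
finite image of EITHER parity and `ψ` of finite image — the `p`-adic automorphy hypothesis being
used only through `IsHeckeAssociatedAt.isUnramifiedAt`.  In particular the instance the route
consumes (`σ` = the `2`-adic model of `ρ|_{Γ_K}`, `ρ` EVEN icosahedral, `ψ = 1`) lies in this
sector: there R′ is implied by the target it serves to prove. [folklore] -/
theorem artinWeightRealisationLevel_descent_sector_of_target : Literature.NumberTheory.Automorphic.strongArtin_of_isSolvable → Literature.NumberTheory.Automorphic.khareWintenberger_artinConjecture_of_isOdd → Literature.NumberTheory.Automorphic.booker_strongArtin_of_artinConjecture → Summit.Langlands.Langlands.Theses.ParityBlindBianchi.EvenIcosahedralStrongArtin → Literature.NumberTheory.Automorphic.baseChange_cyclic_cuspidal → Literature.NumberTheory.Automorphic.JacquetLanglands1970_twistedHeckeTheoryGL2 → ∀ (K : Type) [Field K] [NumberField K], NumberField.IsTotallyComplex K → Module.finrank ℚ K = 2 → ∀ (p : ℕ) [Fact p.Prime] (ι : PadicAlgCl p ≃+* ℂ) (σ : Literature.NumberTheory.GaloisRepresentations.FramedGaloisRep K (PadicAlgCl p) 2), Finite σ.toMonoidHom.range → σ.toGaloisRep.IsIrreducible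 → (∃ (ρ : Literature.NumberTheory.GaloisRepresentations.FramedGaloisRep ℚ (PadicAlgCl p) 2) (ψ : Field.absoluteGaloisGroup K →ₜ* (PadicAlgCl p)ˣ), Finite ρ.toMonoidHom.range ∧ Finite ψ.toMonoidHom.range ∧ Literature.NumberTheory.GaloisRepresentations.FramedRep.twist (ρ.restrictField K) ψ = σ) → ∀ S₀ : Finset ℕ, p ∈ S₀ → (∃ (U : Subgroup (GL (Fin 2) (IsDedekindDomain.FiniteAdeleRing (NumberField.RingOfIntegers K) K))) (ϖ : ∀ v : IsDedekindDomain.HeightOneSpectrum (NumberField.RingOfIntegers K), (v.adicCompletion K)ˣ) (a : {v : IsDedekindDomain.HeightOneSpectrum (NumberField.RingOfIntegers K) // ∀ ℓ ∈ S₀, ((ℓ : ℕ) : NumberField.RingOfIntegers K) ∉ v.asIdeal} → ℕ → (Valued.v (R := PadicAlgCl p)).valuationSubring), IsOpen (U : Set (GL (Fin 2) (IsDedekindDomain.FiniteAdeleRing (NumberField.RingOfIntegers K) K))) ∧ U ≤ Literature.NumberTheory.Automorphic.glFiniteIntegralLevel 2 K ∧ (∀ g ∈ Literature.NumberTheory.Automorphic.glFiniteIntegralLevel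 2 K, (∀ v : IsDedekindDomain.HeightOneSpectrum (NumberField.RingOfIntegers K), ¬ (∀ ℓ ∈ S₀, ((ℓ : ℕ) : NumberField.RingOfIntegers K) ∉ v.asIdeal) → ∀ i j : Fin 2, ((g : Matrix (Fin 2) (Fin 2) (IsDedekindDomain.FiniteAdeleRing (NumberField.RingOfIntegers K) K)) i j) v = (1 : Matrix (Fin 2) (Fin 2) (v.adicCompletion K)) i j) → g ∈ U) ∧ (∀ v : IsDedekindDomain.HeightOneSpectrum (NumberField.RingOfIntegers K), Valued.v ((ϖ v : (v.adicCompletion K)ˣ) : v.adicCompletion K) = WithZero.exp (-1 : ℤ)) ∧ Literature.NumberTheory.Automorphic.IsHeckePoint (Matrix.GeneralLinearGroup.map (n := Fin 2) (algebraMap K (IsDedekindDomain.FiniteAdeleRing (NumberField.RingOfIntegers K) K))) (Literature.NumberTheory.Automorphic.LevelTower.ofSeq U (fun r : ℕ => (Literature.NumberTheory.Automorphic.principalCongruenceLevel 2 K (Ideal.span {((p : ℕ) : NumberField.RingOfIntegers K)} ^ r)).map (Literature.NumberTheory.Automorphic.GLn.sndHom 2 K))) ((p : ℕ) : (Valued.v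 (R := PadicAlgCl p)).valuationSubring) (fun j : {v : IsDedekindDomain.HeightOneSpectrum (NumberField.RingOfIntegers K) // ∀ ℓ ∈ S₀, ((ℓ : ℕ) : NumberField.RingOfIntegers K) ∉ v.asIdeal} × Fin 2 => Literature.NumberTheory.Automorphic.GLn.sndHom 2 K (Literature.NumberTheory.Automorphic.heckeDiagAt 2 K j.1.1 (ϖ j.1.1) (j.2.val + 1))) (fun j => a j.1 (j.2.val + 1)) ∧ ∀ (v : IsDedekindDomain.HeightOneSpectrum (NumberField.RingOfIntegers K)) (hv : ∀ ℓ ∈ S₀, ((ℓ : ℕ) : NumberField.RingOfIntegers K) ∉ v.asIdeal), σ.IsHeckeAssociatedAt v (fun i : ℕ => if i = 0 then (1 : PadicAlgCl p) else ((a ⟨v, hv⟩ i : (Valued.v (R := PadicAlgCl p)).valuationSubring) : PadicAlgCl p))) → ∃ (hcpt : Literature.NumberTheory.Automorphic.isCompact_glFiniteIntegralLevel 2 K) (π : Literature.NumberTheory.Automorphic.CuspidalAutomorphicRepData 2 K hcpt), ∀ w : IsDedekindDomain.HeightOneSpectrum (NumberField.RingOfIntegers K), (∀ ℓ ∈ S₀,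 ((ℓ : ℕ) : NumberField.RingOfIntegers K) ∉ w.asIdeal) → Summit.Langlands.SatakeFrobCompatibleAt ι π.1 σ w := by
  intro hLT hKW hB hT hBC hJL K _ _ _ hdeg p _ ι σ _ hirr hsec S₀ _ hyp
  obtain ⟨ρ, ψ, hfinρ, hψ, rfl⟩ := hsec
  have hirr₀ : (ρ.restrictField K).toGaloisRep.IsIrreducible :=
    (stub_isIrreducible_twist_iff K (PadicAlgCl p) 2 (ρ.restrictField K) ψ).1 hirr
  have hG : frobSatakeCompatibleAt_of_isPiOfArtinRep_of_isUnramifiedAt :=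
    frobSatakeCompatibleAt_of_isPiOfArtinRep_of_isUnramifiedAt_of_JacquetLanglands1970_twistedHeckeTheoryGL2 hJL
  obtain ⟨hcpt, π, hπ⟩ := satakeFrobCompatibleAt_twist_restrictField_of_strongArtin
    (strongArtin_rat_two_of_target hLT hKW hB hT) hBC (fun hcpt τ π hπ v hv => hG hcpt τ π hπ v hv)
    K hdeg p ι ρ hfinρ hirr₀ ψ hψ
  refine ⟨hcpt, π, fun w hw => hπ w ?_⟩
  obtain ⟨U, ϖ, a, -, -, -, -, -, hassoc⟩ := hyp
  exact (hassoc w hw).isUnramifiedAt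

/-- **The open residue of R′ modulo its own target: the NON-DESCENDING icosahedral sector.**
Modulo the six hypotheses — Langlands–Tunnell, KW odd Artin, Booker, the route's target
`EvenIcosahedralStrongArtin`, Arthur–Clozel 4.2 (a), JL — the crux follows from its restriction to
the `σ` with INSOLUBLE (icosahedral) projective image that are NOT of the form `(ρ|_{Γ_K}) ⊗ ψ` for
ANY finite-image `ρ : Γ_ℚ → GL₂(ℚ̄_p)` and finite-image `ψ` ("genuinely Bianchi" icosahedral `σ`,
whose projectivisation does not descend to `Γ_ℚ`) — a sector the route `ParityBlindBianchi` never
consumes. [folklore] -/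
theorem artinWeightRealisationLevel_of_nondescending_sector : Literature.NumberTheory.Automorphic.strongArtin_of_isSolvable → Literature.NumberTheory.Automorphic.khareWintenberger_artinConjecture_of_isOdd → Literature.NumberTheory.Automorphic.booker_strongArtin_of_artinConjecture → Summit.Langlands.Langlands.Theses.ParityBlindBianchi.EvenIcosahedralStrongArtin → Literature.NumberTheory.Automorphic.baseChange_cyclic_cuspidal → Literature.NumberTheory.Automorphic.JacquetLanglands1970_twistedHeckeTheoryGL2 → (∀ (K : Type) [Field K] [NumberField K], NumberField.IsTotallyComplex K → Module.finrank ℚ K = 2 → ∀ (p : ℕ) [Fact p.Prime] (ι : PadicAlgCl p ≃+* ℂ) (σ : Literature.NumberTheory.GaloisRepresentations.FramedGaloisRep K (PadicAlgCl p) 2), Finite σ.toMonoidHom.range → σ.toGaloisRep.IsIrreducible → ¬ IsSolvable (Literature.NumberTheory.GaloisRepresentations.projectiveImage σ.toMonoidHom) → ¬ (∃ (ρ : Literature.NumberTheory.GaloisRepresentations.FramedGaloisRep ℚ (PadicAlgCl p) 2) (ψ : Field.absoluteGaloisGroup K →ₜ* (PadicAlgCl p)ˣ), Finite ρ.toMonoidHom.range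 ∧ Finite ψ.toMonoidHom.range ∧ Literature.NumberTheory.GaloisRepresentations.FramedRep.twist (ρ.restrictField K) ψ = σ) → ∀ S₀ : Finset ℕ, p ∈ S₀ → (∃ (U : Subgroup (GL (Fin 2) (IsDedekindDomain.FiniteAdeleRing (NumberField.RingOfIntegers K) K))) (ϖ : ∀ v : IsDedekindDomain.HeightOneSpectrum (NumberField.RingOfIntegers K), (v.adicCompletion K)ˣ) (a : {v : IsDedekindDomain.HeightOneSpectrum (NumberField.RingOfIntegers K) // ∀ ℓ ∈ S₀, ((ℓ : ℕ) : NumberField.RingOfIntegers K) ∉ v.asIdeal} → ℕ → (Valued.v (R := PadicAlgCl p)).valuationSubring), IsOpen (U : Set (GL (Fin 2) (IsDedekindDomain.FiniteAdeleRing (NumberField.RingOfIntegers K) K))) ∧ U ≤ Literature.NumberTheory.Automorphic.glFiniteIntegralLevel 2 K ∧ (∀ g ∈ Literature.NumberTheory.Automorphic.glFiniteIntegralLevel 2 K, (∀ v : IsDedekindDomain.HeightOneSpectrum (NumberField.RingOfIntegers K), ¬ (∀ ℓ ∈ S₀, ((ℓ : ℕ) : NumberField.RingOfIntegers K) ∉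 v.asIdeal) → ∀ i j : Fin 2, ((g : Matrix (Fin 2) (Fin 2) (IsDedekindDomain.FiniteAdeleRing (NumberField.RingOfIntegers K) K)) i j) v = (1 : Matrix (Fin 2) (Fin 2) (v.adicCompletion K)) i j) → g ∈ U) ∧ (∀ v : IsDedekindDomain.HeightOneSpectrum (NumberField.RingOfIntegers K), Valued.v ((ϖ v : (v.adicCompletion K)ˣ) : v.adicCompletion K) = WithZero.exp (-1 : ℤ)) ∧ Literature.NumberTheory.Automorphic.IsHeckePoint (Matrix.GeneralLinearGroup.map (n := Fin 2) (algebraMap K (IsDedekindDomain.FiniteAdeleRing (NumberField.RingOfIntegers K) K))) (Literature.NumberTheory.Automorphic.LevelTower.ofSeq U (fun r : ℕ => (Literature.NumberTheory.Automorphic.principalCongruenceLevel 2 K (Ideal.span {((p : ℕ) : NumberField.RingOfIntegers K)} ^ r)).map (Literature.NumberTheory.Automorphic.GLn.sndHom 2 K))) ((p : ℕ) : (Valued.v (R := PadicAlgCl p)).valuationSubring) (fun j : {v : IsDedekindDomain.HeightOneSpectrum (NumberField.RingOfIntegers K) // ∀ ℓ ∈ S₀, ((ℓ : ℕ) : NumberField.RingOfIntegers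 K) ∉ v.asIdeal} × Fin 2 => Literature.NumberTheory.Automorphic.GLn.sndHom 2 K (Literature.NumberTheory.Automorphic.heckeDiagAt 2 K j.1.1 (ϖ j.1.1) (j.2.val + 1))) (fun j => a j.1 (j.2.val + 1)) ∧ ∀ (v : IsDedekindDomain.HeightOneSpectrum (NumberField.RingOfIntegers K)) (hv : ∀ ℓ ∈ S₀, ((ℓ : ℕ) : NumberField.RingOfIntegers K) ∉ v.asIdeal), σ.IsHeckeAssociatedAt v (fun i : ℕ => if i = 0 then (1 : PadicAlgCl p) else ((a ⟨v, hv⟩ i : (Valued.v (R := PadicAlgCl p)).valuationSubring) : PadicAlgCl p))) → ∃ (hcpt : Literature.NumberTheory.Automorphic.isCompact_glFiniteIntegralLevel 2 K) (π : Literature.NumberTheory.Automorphic.CuspidalAutomorphicRepData 2 K hcpt), ∀ w : IsDedekindDomain.HeightOneSpectrum (NumberField.RingOfIntegers K), (∀ ℓ ∈ S₀, ((ℓ : ℕ) : NumberField.RingOfIntegers K) ∉ w.asIdeal) → Summit.Langlands.SatakeFrobCompatibleAt ι π.1 σ w) → Summit.Langlands.Langlands.Theses.ParityBlindBianchi.ArtinWeightRealisationLevel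 := by
  intro hLT hKW hB hT hBC hJL h7 K _ _ htc hdeg p _ ι σ hfin hirr S₀ hp hyp
  have hG : frobSatakeCompatibleAt_of_isPiOfArtinRep_of_isUnramifiedAt :=
    frobSatakeCompatibleAt_of_isPiOfArtinRep_of_isUnramifiedAt_of_JacquetLanglands1970_twistedHeckeTheoryGL2 hJL
  by_cases hs : IsSolvable (projectiveImage σ.toMonoidHom)
  · obtain ⟨hcpt, π, hπ⟩ :=
      satakeFrobCompatibleAt_of_isSolvable_projectiveImage hLT
        (fun hcpt σ π hπ v hv => hG hcpt σ π hπ v hv) K p ι σ hfin hirr hs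
    refine ⟨hcpt, π, fun w hw => hπ w ?_⟩
    obtain ⟨U, ϖ, a, -, -, -, -, -, hassoc⟩ := hyp
    exact (hassoc w hw).isUnramifiedAt
  · exact (Classical.em _).elim
      (fun hsec => artinWeightRealisationLevel_descent_sector_of_target hLT hKW hB hT hBC hJL K ‹_› hdeg
        p ι σ hfin hirr hsec S₀ hp hyp)
      (fun hsec => h7 K htc hdeg p ι σ hfin hirr hs hsec S₀ hp hyp)

/-- **The shared crux R on the descent-up-to-twist sector of either parity, from the target**
(a.e. conclusion; no Hecke theory): modulo LT, KW odd Artin, Booker, `EvenIcosahedralStrongArtin`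
and Arthur–Clozel 4.2 (a). [folklore] -/
theorem artinWeightRealisation_descent_sector_of_target : Literature.NumberTheory.Automorphic.strongArtin_of_isSolvable → Literature.NumberTheory.Automorphic.khareWintenberger_artinConjecture_of_isOdd → Literature.NumberTheory.Automorphic.booker_strongArtin_of_artinConjecture → Summit.Langlands.Langlands.Theses.ParityBlindBianchi.EvenIcosahedralStrongArtin → Literature.NumberTheory.Automorphic.baseChange_cyclic_cuspidal → ∀ (K : Type) [Field K] [NumberField K], NumberField.IsTotallyComplex K → Module.finrank ℚ K = 2 → ∀ (p : ℕ) [Fact p.Prime] (ι : PadicAlgCl p ≃+* ℂ) (σ : Literature.NumberTheory.GaloisRepresentations.FramedGaloisRep K (PadicAlgCl p) 2), Finite σ.toMonoidHom.range → σ.toGaloisRep.IsIrreducible → (∃ (ρ : Literature.NumberTheory.GaloisRepresentations.FramedGaloisRep ℚ (PadicAlgCl p) 2) (ψ : Field.absoluteGaloisGroup K →ₜ* (PadicAlgCl p)ˣ), Finite ρ.toMonoidHom.range ∧ Finite ψ.toMonoidHom.range ∧ Literature.NumberTheory.GaloisRepresentations.FramedRep.twist (ρ.restrictField K) ψ = σ)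 → (∃ (S : Finset (IsDedekindDomain.HeightOneSpectrum (NumberField.RingOfIntegers K))) (U : Subgroup (GL (Fin 2) (IsDedekindDomain.FiniteAdeleRing (NumberField.RingOfIntegers K) K))) (ϖ : ∀ v : IsDedekindDomain.HeightOneSpectrum (NumberField.RingOfIntegers K), (v.adicCompletion K)ˣ) (a : {v : IsDedekindDomain.HeightOneSpectrum (NumberField.RingOfIntegers K) // v ∉ S} → ℕ → (Valued.v (R := PadicAlgCl p)).valuationSubring), (∀ v : IsDedekindDomain.HeightOneSpectrum (NumberField.RingOfIntegers K), ((p : ℕ) : NumberField.RingOfIntegers K) ∈ v.asIdeal → v ∈ S) ∧ IsOpen (U : Set (GL (Fin 2) (IsDedekindDomain.FiniteAdeleRing (NumberField.RingOfIntegers K) K))) ∧ U ≤ Literature.NumberTheory.Automorphic.glFiniteIntegralLevel 2 K ∧ (∀ g ∈ Literature.NumberTheory.Automorphic.glFiniteIntegralLevel 2 K, (∀ v ∈ S, ∀ i j : Fin 2, ((g : Matrix (Fin 2) (Fin 2) (IsDedekindDomain.FiniteAdeleRing (NumberField.RingOfIntegers K) K)) i j) v = (1 : Matrix (Fin 2)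 (Fin 2) (v.adicCompletion K)) i j) → g ∈ U) ∧ (∀ v : IsDedekindDomain.HeightOneSpectrum (NumberField.RingOfIntegers K), Valued.v ((ϖ v : (v.adicCompletion K)ˣ) : v.adicCompletion K) = WithZero.exp (-1 : ℤ)) ∧ Literature.NumberTheory.Automorphic.IsHeckePoint (Matrix.GeneralLinearGroup.map (n := Fin 2) (algebraMap K (IsDedekindDomain.FiniteAdeleRing (NumberField.RingOfIntegers K) K))) (Literature.NumberTheory.Automorphic.LevelTower.ofSeq U (fun r : ℕ => (Literature.NumberTheory.Automorphic.principalCongruenceLevel 2 K (Ideal.span {((p : ℕ) : NumberField.RingOfIntegers K)} ^ r)).map (Literature.NumberTheory.Automorphic.GLn.sndHom 2 K))) ((p : ℕ) : (Valued.v (R := PadicAlgCl p)).valuationSubring) (fun j : {v : IsDedekindDomain.HeightOneSpectrum (NumberField.RingOfIntegers K) // v ∉ S} × Fin 2 => Literature.NumberTheory.Automorphic.GLn.sndHom 2 K (Literature.NumberTheory.Automorphic.heckeDiagAt 2 K j.1.1 (ϖ j.1.1) (j.2.val + 1))) (fun j => a j.1 (j.2.val + 1)) ∧ ∀ (v : IsDedekindDomain.HeightOneSpectrum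 (NumberField.RingOfIntegers K)) (hv : v ∉ S), σ.IsHeckeAssociatedAt v (fun i : ℕ => if i = 0 then (1 : PadicAlgCl p) else ((a ⟨v, hv⟩ i : (Valued.v (R := PadicAlgCl p)).valuationSubring) : PadicAlgCl p))) → ∃ (hcpt : Literature.NumberTheory.Automorphic.isCompact_glFiniteIntegralLevel 2 K) (π : Literature.NumberTheory.Automorphic.CuspidalAutomorphicRepData 2 K hcpt), ∀ᶠ w : IsDedekindDomain.HeightOneSpectrum (NumberField.RingOfIntegers K) in Filter.cofinite, Summit.Langlands.SatakeFrobCompatibleAt ι π.1 σ w := by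
  intro hLT hKW hB hT hBC K _ _ _ hdeg p _ ι σ _ hirr hsec _
  obtain ⟨ρ, ψ, hfinρ, hψ, rfl⟩ := hsec
  have hirr₀ : (ρ.restrictField K).toGaloisRep.IsIrreducible :=
    (stub_isIrreducible_twist_iff K (PadicAlgCl p) 2 (ρ.restrictField K) ψ).1 hirr
  exact eventually_satakeFrobCompatibleAt_twist_restrictField_of_strongArtin
    (strongArtin_rat_two_of_target hLT hKW hB hT) hBC K hdeg p ι ρ hfinρ hirr₀ ψ hψ

/-- **The open residue of the shared crux R modulo the target: the non-descending icosahedral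
sector** (five hypotheses: LT, KW odd Artin, Booker, `EvenIcosahedralStrongArtin`, Arthur–Clozel
4.2 (a); no Hecke theory). [folklore] -/
theorem artinWeightRealisation_of_nondescending_sector : Literature.NumberTheory.Automorphic.strongArtin_of_isSolvable → Literature.NumberTheory.Automorphic.khareWintenberger_artinConjecture_of_isOdd → Literature.NumberTheory.Automorphic.booker_strongArtin_of_artinConjecture → Summit.Langlands.Langlands.Theses.ParityBlindBianchi.EvenIcosahedralStrongArtin → Literature.NumberTheory.Automorphic.baseChange_cyclic_cuspidal → (∀ (K : Type) [Field K] [NumberField K], NumberField.IsTotallyComplex K → Module.finrank ℚ K = 2 → ∀ (p : ℕ) [Fact p.Prime] (ι : PadicAlgCl p ≃+* ℂ) (σ : Literature.NumberTheory.GaloisRepresentations.FramedGaloisRep K (PadicAlgCl p) 2), Finite σ.toMonoidHom.range → σ.toGaloisRep.IsIrreducible → ¬ IsSolvable (Literature.NumberTheory.GaloisRepresentations.projectiveImage σ.toMonoidHom) → ¬ (∃ (ρ : Literature.NumberTheory.GaloisRepresentations.FramedGaloisRep ℚ (PadicAlgCl p) 2) (ψ : Field.absoluteGaloisGroup K →ₜ*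 (PadicAlgCl p)ˣ), Finite ρ.toMonoidHom.range ∧ Finite ψ.toMonoidHom.range ∧ Literature.NumberTheory.GaloisRepresentations.FramedRep.twist (ρ.restrictField K) ψ = σ) → (∃ (S : Finset (IsDedekindDomain.HeightOneSpectrum (NumberField.RingOfIntegers K))) (U : Subgroup (GL (Fin 2) (IsDedekindDomain.FiniteAdeleRing (NumberField.RingOfIntegers K) K))) (ϖ : ∀ v : IsDedekindDomain.HeightOneSpectrum (NumberField.RingOfIntegers K), (v.adicCompletion K)ˣ) (a : {v : IsDedekindDomain.HeightOneSpectrum (NumberField.RingOfIntegers K) // v ∉ S} → ℕ → (Valued.v (R := PadicAlgCl p)).valuationSubring), (∀ v : IsDedekindDomain.HeightOneSpectrum (NumberField.RingOfIntegers K), ((p : ℕ) : NumberField.RingOfIntegers K) ∈ v.asIdeal → v ∈ S) ∧ IsOpen (U : Set (GL (Fin 2) (IsDedekindDomain.FiniteAdeleRing (NumberField.RingOfIntegers K) K))) ∧ U ≤ Literature.NumberTheory.Automorphic.glFiniteIntegralLevel 2 K ∧ (∀ g ∈ Literature.NumberTheory.Automorphic.glFiniteIntegralLevel 2 K, (∀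 v ∈ S, ∀ i j : Fin 2, ((g : Matrix (Fin 2) (Fin 2) (IsDedekindDomain.FiniteAdeleRing (NumberField.RingOfIntegers K) K)) i j) v = (1 : Matrix (Fin 2) (Fin 2) (v.adicCompletion K)) i j) → g ∈ U) ∧ (∀ v : IsDedekindDomain.HeightOneSpectrum (NumberField.RingOfIntegers K), Valued.v ((ϖ v : (v.adicCompletion K)ˣ) : v.adicCompletion K) = WithZero.exp (-1 : ℤ)) ∧ Literature.NumberTheory.Automorphic.IsHeckePoint (Matrix.GeneralLinearGroup.map (n := Fin 2) (algebraMap K (IsDedekindDomain.FiniteAdeleRing (NumberField.RingOfIntegers K) K))) (Literature.NumberTheory.Automorphic.LevelTower.ofSeq U (fun r : ℕ => (Literature.NumberTheory.Automorphic.principalCongruenceLevel 2 K (Ideal.span {((p : ℕ) : NumberField.RingOfIntegers K)} ^ r)).map (Literature.NumberTheory.Automorphic.GLn.sndHom 2 K))) ((p : ℕ) : (Valued.v (R := PadicAlgCl p)).valuationSubring) (fun j : {v : IsDedekindDomain.HeightOneSpectrum (NumberField.RingOfIntegers K) // v ∉ S} × Fin 2 => Literature.NumberTheory.Automorphic.GLn.sndHom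 2 K (Literature.NumberTheory.Automorphic.heckeDiagAt 2 K j.1.1 (ϖ j.1.1) (j.2.val + 1))) (fun j => a j.1 (j.2.val + 1)) ∧ ∀ (v : IsDedekindDomain.HeightOneSpectrum (NumberField.RingOfIntegers K)) (hv : v ∉ S), σ.IsHeckeAssociatedAt v (fun i : ℕ => if i = 0 then (1 : PadicAlgCl p) else ((a ⟨v, hv⟩ i : (Valued.v (R := PadicAlgCl p)).valuationSubring) : PadicAlgCl p))) → ∃ (hcpt : Literature.NumberTheory.Automorphic.isCompact_glFiniteIntegralLevel 2 K) (π : Literature.NumberTheory.Automorphic.CuspidalAutomorphicRepData 2 K hcpt), ∀ᶠ w : IsDedekindDomain.HeightOneSpectrum (NumberField.RingOfIntegers K) in Filter.cofinite, Summit.Langlands.SatakeFrobCompatibleAt ι π.1 σ w) → Summit.Langlands.Langlands.Theses.RuelleTorsionArtinWeight.ArtinWeightRealisation := by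
  intro hLT hKW hB hT hBC h6
  refine artinWeightRealisation_of_residual_sector hLT hKW hB hBC ?_
  intro K _ _ htc hdeg p _ ι σ hfin hirr hs _ hyp
  exact (Classical.em _).elim
    (fun hsec => artinWeightRealisation_descent_sector_of_target hLT hKW hB hT hBC K htc hdeg p ι σ hfin
      hirr hsec hyp)
    (fun hsec => h6 K htc hdeg p ι σ hfin hirr hs hsec hyp)

end Summit.Langlands.Langlands.Theorems.ArtinWeightRealisationLevel

end
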